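import Mathlib
import Literature.AlgebraicGeometry.Resolution.CutkoskySurfaceOmegaSequence
import Literature.AlgebraicGeometry.Resolution.Isolation
import Literature.AlgebraicGeometry.Resolution.WeightedQuasiRegularRelative
import Literature.AlgebraicGeometry.Resolution.PointChartPresentation
import HarnessLib

/-!
# Cutkosky 2009, §10.1 obs. 3–4 / proof of Thm. 10.18: at a POINT step `α < 1` and some vertex lies below `b = 1` (PROVED)

Topic: `Literature/AlgebraicGeometry/Resolution`.  S. D. Cutkosky, *Resolution of singularities for
3-folds in positive characteristic*, Amer. J. Math. **131** (2009) 59–127 [cite: Cutkosky2009],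
§10.1 p. 28 l. 62–63: "3. `α < 1` if and only if `I ⊄ (x, z)^r`", "4. A vertex of `|Δ|` lies below
the line `b = 1` if and only if `I ⊄ (y, z)^r`"; used in the proof of Theorem 10.18 through Lemma
10.14 ("We need the assumption `Sing_r(I) = V(x, y, z)` so that `β < 1`", p. 33 l. 66–68) and Lemma
10.15 ("Since `Sing_r(I) = V(x, y, z)` by assumption, we have `α < 1`", p. 34 l. 1–2).

In the vocabulary of the `τ = 1` sequences of `CutkoskySurfaceOmegaSequence.lean`, "`Sing_r(I) =
V(x, y, z)`" is the point-step branch `∀ P ≠ 𝔪, ¬ InSingR I r P` of `TauOneChain.step`; applied to the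
prime ideals `(z, x)` and `(z, y)` (primes: `WeightedQuasiRegularRelative.isPrime_span_pair`; proper
sub-ideals of `𝔪`: linear independence of a regular system modulo `𝔪²`,
`PointChartPresentation.mem_maximalIdeal_of_lin_mem_sq`) it gives `I ⊄ (z, x)^r`, `I ⊄ (z, y)^r`, whence
the tree's isolation inequalities (`Isolation.alphaS_lt_of_not_le_span_pair_pow`,
`epsS_lt_of_not_le_span_pair_pow`; Cossart–Piltant (16)): `alphaS < L` and `epsS < L` (a Newton point
below `b = 1`, the hypothesis `hyz` of `CutkoskySurfaceOmegaPointChart.cuStep_colon_point`).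

## What is PROVED (theorems only; no definition, no fact)

* `span_pair_ne_maximalIdeal`, `span_pair_ne_maximalIdeal'` — `(c 0, c 1) ≠ 𝔪`, `(c 0, c 2) ≠ 𝔪`;
* `not_le_span_pair_pow_of_not_inSingR` — `¬ InSingR I r (c 0, c 1)` ⇒ `I ⊄ (c 0, c 1)^r` (and the
  `(c 0, c 2)` variant);
* `alphaS_lt_of_pointBranch`, `exists_spt₂_lt_of_pointBranch` — the two inequalities at a point step.

AI-written; weaker than expert review.

## Sources

* S. D. Cutkosky, Amer. J. Math. 131 (2009), §10.1 obs. 3–4 p. 28 l. 62–63; Lemma 10.14 p. 33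
  l. 66–68; Lemma 10.15 p. 34 l. 1–2. [Cutkosky2009]
* V. Cossart, O. Piltant, J. Algebra 320 (2008), (16). [CossartPiltant2008]
-/

noncomputable section

open IsLocalRing

namespace Literature.AlgebraicGeometry.Resolution.Cutkosky2009

universe u

variable {R : Type u} [CommRing R] [IsRegularLocalRing R] {c : Fin 3 → R}
  (hgen : Ideal.span {c 0, c 1, c 2} = maximalIdeal R) (hdim : ringKrullDim R = 3)

include hgen hdim in
/-- `(z, x) ≠ 𝔪`: the third parameter is not in the span of the first two.
[cite: Cutkosky2009, §10.1 p. 28 l. 62] -/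
theorem span_pair_ne_maximalIdeal : Ideal.span {c 0, c 1} ≠ maximalIdeal R := by
  intro h
  have hc2 : c 2 ∈ Ideal.span ({c 0, c 1} : Set R) := by
    rw [h, ← hgen]; exact Ideal.subset_span (by simp)
  obtain ⟨a, b, hab⟩ := Ideal.mem_span_pair.mp hc2
  have h0 : (![a, b, -1] : Fin 3 → R) 0 * c 0 + (![a, b, -1] : Fin 3 → R) 1 * c 1 +
      (![a, b, -1] : Fin 3 → R) 2 * c 2 ∈ maximalIdeal R ^ 2 := by
    have : (![a, b, -1] : Fin 3 → R) 0 * c 0 + (![a, b, -1] : Fin 3 → R) 1 * c 1 +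
        (![a, b, -1] : Fin 3 → R) 2 * c 2 = 0 := by simp; rw [← hab]; ring
    rw [this]; exact Ideal.zero_mem _
  have := mem_maximalIdeal_of_lin_mem_sq c hgen hdim ![a, b, -1] h0 2
  simp at this

include hgen hdim in
/-- `(z, y) ≠ 𝔪`. [cite: Cutkosky2009, §10.1 p. 28 l. 63] -/
theorem span_pair_ne_maximalIdeal' : Ideal.span {c 0, c 2} ≠ maximalIdeal R := by
  intro h
  have hc1 : c 1 ∈ Ideal.span ({c 0, c 2} : Set R) := by
    rw [h, ← hgen]; exact Ideal.subset_span (by simp)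
  obtain ⟨a, b, hab⟩ := Ideal.mem_span_pair.mp hc1
  have h0 : (![a, -1, b] : Fin 3 → R) 0 * c 0 + (![a, -1, b] : Fin 3 → R) 1 * c 1 +
      (![a, -1, b] : Fin 3 → R) 2 * c 2 ∈ maximalIdeal R ^ 2 := by
    have : (![a, -1, b] : Fin 3 → R) 0 * c 0 + (![a, -1, b] : Fin 3 → R) 1 * c 1 +
        (![a, -1, b] : Fin 3 → R) 2 * c 2 = 0 := by simp; rw [← hab]; ring
    rw [this]; exact Ideal.zero_mem _
  have := mem_maximalIdeal_of_lin_mem_sq c hgen hdim ![a, -1, b] h0 1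
  simp at this

include hgen hdim in
/-- **`Sing_r(I) ∌ V(z, x)` ⇒ `I ⊄ (z, x)^r`** (the contrapositive of "`I ⊂ (x, z)^r` ⇒ `V(x, z) ⊂
Sing_r(I)`", with `(z, x)` prime). [cite: Cutkosky2009, §10.1 obs. 3 p. 28 l. 62] -/
theorem not_le_span_pair_pow_of_not_inSingR {I : Ideal R} {r : ℕ}
    (h : ¬ InSingR I r (Ideal.span {c 0, c 1})) : ¬ I ≤ Ideal.span {c 0, c 1} ^ r := by
  intro hle
  apply h
  have hP : (Ideal.span {c 0, c 1} : Ideal R).IsPrime :=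
    isPrime_span_pair (c 0) (c 1) (c 2) hgen
      (by have h := IsRegularLocalRing.spanFinrank_maximalIdeal (R := R)
          rw [hdim] at h; exact_mod_cast h)
  exact ⟨hP, fun g hg => ⟨1, fun h1 => hP.ne_top ((Ideal.eq_top_iff_one _).mpr h1),
    by simpa using hle hg⟩⟩

include hgen hdim in
/-- The `(z, y)` variant: `Sing_r(I) ∌ V(z, y)` ⇒ `I ⊄ (z, y)^r`.
[cite: Cutkosky2009, §10.1 obs. 4 p. 28 l. 63] -/
theorem not_le_span_pair_pow_of_not_inSingR' {I : Ideal R} {r : ℕ}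
    (h : ¬ InSingR I r (Ideal.span {c 0, c 2})) : ¬ I ≤ Ideal.span {c 0, c 2} ^ r := by
  intro hle
  apply h
  have hgen' : Ideal.span {c 0, c 2, c 1} = maximalIdeal R := by
    rw [← hgen]; congr 1; ext a; simp only [Set.mem_insert_iff, Set.mem_singleton_iff]; tauto
  have hP : (Ideal.span {c 0, c 2} : Ideal R).IsPrime :=
    isPrime_span_pair (c 0) (c 2) (c 1) hgen'
      (by have h := IsRegularLocalRing.spanFinrank_maximalIdeal (R := R)
          rw [hdim] at h; exact_mod_cast h)
  exact ⟨hP, fun g hg => ⟨1, fun h1 => hP.ne_top ((Ideal.eq_top_iff_one _).mpr h1),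
    by simpa using hle hg⟩⟩

include hgen hdim in
/-- **At a point step `α < 1`** (scaled `alphaS < L`) and the polygon is non-empty: from
"`Sing_r(I) = V(x, y, z)`" in the form `∀ P ≠ 𝔪, ¬ InSingR I r P`.
[cite: Cutkosky2009, Lemma 10.15 proof p. 34 l. 1–2; §10.1 obs. 3] [cite: CossartPiltant2008, (16)] -/
theorem alphaS_lt_of_pointBranch {I : Ideal R} {r : ℕ}
    (hpt : ∀ P, P ≠ maximalIdeal R → ¬ InSingR I r P) :
    (pts c I r).Nonempty ∧ alphaS c I r < r.factorial :=
  alphaS_lt_of_not_le_span_pair_pow c hgen hdim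
    (not_le_span_pair_pow_of_not_inSingR hgen hdim (hpt _ (span_pair_ne_maximalIdeal hgen hdim)))

include hgen hdim in
/-- **At a point step some vertex lies below `b = 1`** (scaled: a Newton point with `spt₂ < L`,
`epsS < L`). [cite: Cutkosky2009, §10.1 obs. 4 p. 28 l. 63; Lemma 10.14 p. 33 l. 66–68]
[cite: CossartPiltant2008, (16)] -/
theorem exists_spt₂_lt_of_pointBranch {I : Ideal R} {r : ℕ}
    (hpt : ∀ P, P ≠ maximalIdeal R → ¬ InSingR I r P) :
    epsS c I r < r.factorial ∧ ∃ e ∈ pts c I r, spt₂ r e < r.factorial := by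
  obtain ⟨hne, hε⟩ := epsS_lt_of_not_le_span_pair_pow c hgen hdim
    (not_le_span_pair_pow_of_not_inSingR' hgen hdim (hpt _ (span_pair_ne_maximalIdeal' hgen hdim)))
  obtain ⟨e, he, hεe⟩ := exists_pts_epsS (c := c) hne
  exact ⟨hε, e, he, by rw [hεe]; exact hε⟩

end Literature.AlgebraicGeometry.Resolution.Cutkosky2009
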